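import Literature.MathematicalPhysics.QuantumFieldTheory.Balaban1983to89.B2Eq265Dictionary

/-!
# `Balaban1983to89.B2Eq265PrintedRemainder` — [Balaban1982Higgs2] Lemma 2.4 (2.65) p.572, value clause «under the restrictions (2.55)»,
# on the (Higgs)₂,₃ carrier of record: F20's bound with the (2.5) DICTIONARY APPLIED — the remainder of (2.65) is
# `C′a_k s^κ + C″p(s) + C‴s^{κ₀}` at the physical scale `s ⇐ Lᵏε`, i.e. print's «O(p(Lᵏε))» up to the explicit `(Lᵏε)^κ`, `(Lᵏε)^{κ₀}`
# tails print also writes (`eq265_higgs_region_remainder`, `eq265_higgs_tower_remainder`; printed instance `β = 1`: `…_remainder_printed`)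

statement-level skeleton of published theorems with citation tags; proofs where landed; nothing here is a claim
about the Yang–Mills mass gap

PDF held: `paper:balaban1982-cmp86-higgs23-ii` (journal page = PDF page + 554), p. 572 [PDF 18] (Lemma 2.4 (2.65) «φ^{(k)}(x) = U(A^{(k)}(Γ^{(k)}_{x,y}))φ(y)
+ O(p(Lᵏε)) for x ∈ Bᵏ(y), y ∈ Λ₂^{(k−1)′}»; «Let us define □₁, □₂ as the sums of large blocks contained in Λ₋₁^{(k−1)′} and distant from the
point y less than 2r(Lᵏε), 4r(Lᵏε) respectively»; (2.67) «+ O((Lᵏε)^κ)»; «A^{(k)} − A₀ = O(p(Lᵏε)r(Lᵏε))»; (2.68) «+ O((Lᵏε)^{κ₀}), κ₀ > 0»),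
p. 573 [PDF 19] ((2.74)–(2.76) «= φ′(y) + O(p(Lᵏε))»; «Combining the equalities (2.67), (2.68), (2.74), (2.76) … we finally get (2.65)»),
p. 557 [PDF 3] ((2.1)–(2.2) «p(ε) = b₀(1 + log ε⁻¹)ᵖ»; (2.5) «λ(ε) = λε^{4−d}, e(ε) = eε^{(4−d)/2}»), p. 558 [PDF 4] ((2.7) «r(ε) = R(1 + log ε⁻¹)ʳ»),
p. 570 [PDF 16] ((2.55)), p. 571 [PDF 17] ((2.60)).

CITATION HEADER (lean-in-tree rule).  T. Bałaban, *(Higgs)₂,₃ quantum fields in a finite volume. II. An upper bound*,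
Commun. Math. Phys. **86** (1982) 555–594, doi:10.1007/bf01214890 [Balaban1982Higgs2].  Cell `lit-balaban` (HOME
`run/shared/lean/pub/lit-balaban/`), Phase-2 proof seat **p23** gen 24 (unit `lit-balaban-p23-g24`; free-target protocol G.5-34(d), TAKING #1
line HOME/STATUS.md 2026-08-23; r02 g49's OWNER RULING on reading question Q-p23g23-2, seat INBOX 2026-08-23T12:05:55Z: (Q2a) `T2` by
`ℓ ≤ 1`; (Q2b) `e_c` against `e·s^{(4−d)/2}`, `S` against `r(s)`, explicit exponent condition on the free `β`, printed instance `β = 1`; (Q2c)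
ONE hypothesis `m²ℓ² ≤ m₁²s²`, neither reading typed); SKELETON row **B2.Lem2.4** (fold owner r02, second reader r14; head `proved p250408 ·
…` UNCHANGED — cells-only member, brick F21).  USED BY NAME, never restated: own F20 `B2Eq265SmallCharge.eq265_higgs_region_size_charge` /
`eq265_higgs_tower_size_charge` and F21a `B2Eq265Dictionary.dictionary_bound`; b2b's `B1.aSeq_le`, `B1.ainf_lt_aSeq`.

THE ARGUMENT.  F20 bounds `‖φ^{(k)}(x) − U(A^{(k)}(Γ))φ(y)‖` by `T1 + T2 + T3 + T4` (the (2.76) tail `C′a_k s^κ`; the `λ_A` line; the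
threshold × charge × side-of-`□₂` group; the (2.75) mass ratio).  `B2Eq265Dictionary.dictionary_bound` is exactly `T2 + T3 + T4 ≤ C″p(s) +
C‴s^{κ₀}` once `a(1 − L⁻²) ≤ a_k ≤ a` ([Balaban1982Higgs1] (2.15): `B1.ainf_lt_aSeq`, `B1.aSeq_le`), `0 < ℓ = P.mesh k ≤ 1` (the telescope's
`h1`), and the three located dictionary hypotheses hold; add `T1`.

WHAT THIS FILE PROVES (kernel-checked, zero `sorry`; theorems only — NO definition, NO `Prop`-valued fact; axioms standard).
 **`eq265_higgs_region_remainder`** — F20's `eq265_higgs_region_size_charge` word for word except (located edits): `(hd3 : d ≤ 3)`;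
 letters `{ē θ₃ m₁ κ₀ : ℝ}` with `0 ≤ ē`, `0 ≤ θ₃`, `κ₀ + (4−d)/4 < β(4−d)/2`, `κ₀ + (4−d)/4 < 2` in the signature; `∃ C″ C‴ ≥ 0` after
 `∃ E₁ E₂ E₃` (chosen from the fixed data and `K₀`, before `∀ P, s`); hypotheses `(Sbox : ℝ) ≤ θ₃·r(s) →`, `msq·(P.mesh k)² ≤ m₁²·s² →`
 next to the radii readings and `ec ≤ ē·s^{(4−d)/2} →` after `ec ≤ e₁ →`; conclusion `≤ C′·a_k·s^κ + C″·p(s) + C‴·s^{κ₀}`.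
 **`eq265_higgs_tower_remainder`** — the same over F20's `eq265_higgs_tower_size_charge` (print's tower regions, cube size `M`, level `j + 1`).
 **`eq265_higgs_region_remainder_printed`** — the PRINTED INSTANCE `β = 1` of the region form: regularity pair `(c_reg, 1)`, the single
 exponent condition `κ₀ < (4−d)/4` (via `B2Eq265Dictionary.printed_exponents`).

HONEST SCOPE / DIFFERENCES FROM PRINT (recorded, not hidden; one sentence each).  (a) The remainder now has print's SHAPE «O(p(Lᵏε))» + the
`(Lᵏε)^κ`/`(Lᵏε)^{κ₀}` tails, with `C″ = 4K₀dC₃·a·c₁(1 + log L)ᵖ` and `C‴` displayed in `B2Eq265Dictionary` (they depend on `d, L, a, λ, c₁,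
b₀, p, R, r, c_reg, β, ē, θ₃, m₁, κ₀` and on `K₀, C₃, E₁, E₂, E₃`); print's single «O(p(Lᵏε))» absorbs `s^{κ₀} ≤ 1 ≤ p(s)/b₀` — we keep the
groups apart.  (b) The dictionary enters as three HYPOTHESES on free letters: `e_c ≤ ē·s^{(4−d)/2}` (print's `e(Lᵏε) = e(Lᵏε)^{(4−d)/2}`,
`ē ⇐ e`; F20's `0 < e_c ≤ e₁` kept, the instantiation `e_c := ē s^{(4−d)/2}` is the special case), `S ≤ θ₃r(s)` (print: `□₂` = blocks within
`4r(Lᵏε)` of `y`, so `S = 8r(Lᵏε) + O(1) ≤ θ₃r(Lᵏε)` with `θ₃ = 8 + O(1)/R`; `θ₃` free like `θ₁, θ₂`), `m²ℓ² ≤ m₁²s²` (`m₁ ⇐ m` of (2.1);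
the same number under both readings of Q-p23g23-1, so neither identification is typed).  (c) `β, c_reg` are the FREE regularity pair of
F8's hypothesis; the exponent condition is explicit; the printed instance `β = 1` needs only `κ₀ < (4−d)/4`
(`B2Eq265Dictionary.printed_exponents`); print says «κ₀ > 0».  (d) `d ≤ 3` = print's «d = 2, 3».  (e) Unchanged from F20: `h1`, `ℓ′ = s/L`,
`c₁, λ` in front, `μ₀` free, `θ₁, θ₂, κ` read, the two smallness hypotheses («e(ε) sufficiently small») stay hypotheses; bookkeeping only;
nothing minted.  NOT summit progress.
-/

open scoped BigOperators

noncomputable section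

namespace Literature.MathematicalPhysics.QuantumFieldTheory.Balaban1983to89.B2Eq265PrintedRemainder

open HiggsLattice (ChargeData)
open HiggsAveraging (blockIter toFinest)
open HiggsCovariance (avgQkAdj)
open B2Eq255Concrete (bgScalar256 underRegion mem_underRegion Restr255 Restr255Printed)
open B2Eq265SmallCharge (eq265_higgs_region_size_charge eq265_higgs_tower_size_charge)
open B2Eq265Dictionary (dictionary_bound)
open B2Eq324NestedRegions (prime)
open B2Eq243RegionsTower (towerRegion)
open B2Eq28RegionsConcrete (near)
open B2Lemma23HiggsLattice (cutMin)
open B1Eq211ZeroFieldTorus (Shape)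
open B3MultiscaleFields (toSite ofSite)
open B1Ineq225RegularBox (cellBox)
open B1TorusRegionHSizes (IsBigBlockUnion)
open B1TorusCubeCover (half)
open B1TorusCubeLocality26 (rS)

variable {P : HiggsLattice.Params} {k : ℕ}

/-! ## §1 General regions, cube size `K₀ ∣ M` -/

/-- **LEMMA 2.4 (2.65), VALUE CLAUSE, UNDER THE PRINTED RESTRICTIONS (2.55), WITH THE (2.5) DICTIONARY APPLIED: the remainder is
`C′a_k s^κ + C″p(s) + C‴s^{κ₀}` at `s ⇐ Lᵏε`.**  TYPED vs PRINTED: own F20 `B2Eq265SmallCharge.eq265_higgs_region_size_charge` word for word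
except the located edits listed in the header (`d ≤ 3`; letters `ē, θ₃, m₁, κ₀` with the two exponent conditions; `∃ C″ C‴ ≥ 0`; the
three dictionary hypotheses; the three-term conclusion); print writes the whole remainder «O(p(Lᵏε))».  [cite: Balaban1982Higgs2, Lemma 2.4 (2.65) p.572]
[cite: Balaban1982Higgs2, Lemma 2.4 proof p.572 «□₁, □₂ … distant from the point y less than 2r(Lᵏε), 4r(Lᵏε)», «A^{(k)} − A₀ = O(p(Lᵏε)r(Lᵏε))», (2.67) «+ O((Lᵏε)^κ)», (2.68) «+ O((Lᵏε)^{κ₀}), κ₀ > 0»; p.573 (2.74)–(2.76) «+ O(p(Lᵏε))»]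
[cite: Balaban1982Higgs2, (2.5) p.557 «λ(ε) = λε^{4−d}, e(ε) = eε^{(4−d)/2}», (2.1)–(2.2) p.557, (2.7) p.558, (2.55)–(2.56) p.570, (2.60) p.571] -/
theorem eq265_higgs_region_remainder (d L : ℕ) (hd : 1 ≤ d) (hd3 : d ≤ 3) (hL : Odd L ∧ 1 < L) {a : ℝ} (ha : 0 < a) {msq : ℝ} (hmsq : 0 < msq)
    {aV : ℝ} (haV : 0 < aV) {mu0sq : ℝ} (hmu0 : 0 < mu0sq)
    (N : ℕ) (C : ChargeData N) (ε₀ : ℝ) (creg β : ℝ) (hcreg : 0 ≤ creg) (hβ : 0 < β)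
    (Q : B2.Params) (hQ : Q.Printed) {c₁ lam : ℝ} (hc₁ : 0 ≤ c₁) (hlam : 0 < lam) {θ₁ θ₂ : ℝ} (hθ₁ : 0 < θ₁) (hθ₂ : 0 < θ₂)
    (κ : ℝ) {ebar θ₃ m₁ κ₀ : ℝ} (hebar : 0 ≤ ebar) (hθ₃ : 0 ≤ θ₃)
    (hκ₁ : κ₀ + ((4 : ℝ) - d) / 4 < β * (((4 : ℝ) - d) / 2)) (hκ₂ : κ₀ + ((4 : ℝ) - d) / 4 < 2) :
    ∃ δ CV CF : ℝ, 0 < δ ∧ 0 < CV ∧ 0 < CF ∧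
    ∃ K₀min : ℕ, ∀ K₀ : ℕ, K₀min ≤ K₀ → ∃ e₁ t : ℝ, 0 < e₁ ∧ 0 < t ∧
      ∃ C₁ C₂ C₃ D₁ D₂ D₃ D₄ : ℝ, 0 ≤ C₁ ∧ 0 ≤ C₂ ∧ 0 ≤ C₃ ∧ 0 ≤ D₁ ∧ 0 ≤ D₂ ∧ 0 ≤ D₃ ∧ 0 ≤ D₄ ∧ ∃ C' : ℝ, 0 ≤ C' ∧
      ∃ E₁ E₂ E₃ : ℝ, 0 ≤ E₁ ∧ 0 ≤ E₂ ∧ 0 ≤ E₃ ∧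
      ∃ C'' C''' : ℝ, 0 ≤ C'' ∧ 0 ≤ C''' ∧
      ∀ (P : HiggsLattice.Params) (_ : Shape P), P.d = d → P.L = L → K₀ ∣ P.M →
      ∀ {k : ℕ}, 1 ≤ k → k ≤ P.K → (∀ μ, 3 * half P k K₀ ≤ P.sitesPerDir 0 μ) → P.mesh k ≤ ε₀ → P.mesh k ≤ 1 →
      ∀ (Λ₂ Λ₆ sq₂ sq₁ : Finset (HiggsLattice.Site P k)) (S : Fin P.d → Finset ℕ) (q : HiggsLattice.Site P k) (Sbox : ℕ),
        Λ₆ ⊆ Λ₂ → sq₂ ⊆ Λ₂ → sq₁ ⊆ Λ₆ →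
        IsBigBlockUnion k K₀ (underRegion k Λ₂) → underRegion k sq₂ = cellBox k K₀ S →
        (∀ μ : Fin P.d, P.L ^ k * Sbox < P.sitesPerDir 0 μ) →
      -- `□₂` IS the box `q + [0,S)ᵈ` of coarse sites, `□ = B^k(□₂)` smaller than half the torus
        (∀ y : HiggsLattice.Site P k, y ∈ sq₂ ↔ ∀ ν : Fin P.d, (y ν - q ν).val < Sbox) →
        (∀ μ : Fin P.d, 2 * (P.L ^ k * Sbox) ≤ P.sitesPerDir 0 μ) →
      -- `□₁` is the box of coarse sites of radius `R₁` (corner `q₁`); `m ≥ R₁` a coarse margin with `Lᵏm ≥` the depth radius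
      ∀ (q₁ : HiggsLattice.Site P k) (R₁ m : ℕ), R₁ ≤ m → 2 * rS P k K₀ + 2 * half P k K₀ * (P.d + 1) + 1 ≤ P.L ^ k * m →
        (∀ y : HiggsLattice.Site P k, y ∈ sq₁ ↔ ∀ ν : Fin P.d, (y ν - q₁ ν).val < 2 * R₁ + 1) →
      -- the region `Λ₋₁` of (2.55); the cutoff `ζ^{(k)}` of (2.44); the cube of radius `R_n ≥ ρ + 1` about every `y ∈ Λ₂` inside `Λ₋₁` ((2.8))
      ∀ (Λm1 : Finset (HiggsLattice.Site P k))
        (ζ : HiggsLattice.Site P 0 → HiggsLattice.Site P k → ℝ) (ρ ρ₁ : ℝ), 0 ≤ ρ₁ →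
        (∀ x y', |ζ x y'| ≤ 1) →
        (∀ x y', ζ x y' ≠ 0 → (HiggsLattice.Site.tdist (blockIter k x) y' : ℝ) ≤ ρ) →
        (∀ x y', (HiggsLattice.Site.tdist (blockIter k x) y' : ℝ) ≤ ρ₁ → ζ x y' = 1) →
        (∀ (x : HiggsLattice.Site P 0) (ν : Fin P.d) (y' : HiggsLattice.Site P k), |ζ (x.shift ν) y' - ζ x y'| ≤ ((P.L : ℝ) ^ k)⁻¹) →
      ∀ (Rn : ℕ), ρ + 1 ≤ (Rn : ℝ) → (∀ μ : Fin P.d, 2 * (2 * Rn + 1) ≤ P.sitesPerDir k μ) →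
        (∀ y ∈ Λ₂, ∀ y' : HiggsLattice.Site P k, HiggsLattice.Site.tdist y y' ≤ Rn → y' ∈ Λm1) →
      -- a charge datum on `ℝ^d`, the step's vector field `A′`, and print's `μ₀` of the (2.55)₂ threshold
      ∀ (C₀ : ChargeData P.d) (A' : HiggsLattice.VecField P k) {μ₀ : ℝ}, 0 < μ₀ →
      -- THE PHYSICAL SCALE `s ⇐ Lᵏε` AS A FREE LETTER (F18a), the (2.55) letter `L^{k−1}ε ⇐ s/L`: radii readings `m ≥ θ₁r(s)`, `R₁ + 1 ≥ θ₂r(s)`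
      ∀ {s : ℝ}, 0 < s → s ≤ 1 →
        θ₁ * B2.rFn Q.R Q.r s ≤ (m : ℝ) → θ₂ * B2.rFn Q.R Q.r s ≤ (R₁ : ℝ) + 1 →
      -- THE DICTIONARY READ at `s ⇐ Lᵏε`: the side of `□₂` `S ≤ θ₃r(s)` (p.572, (2.7)), the mass term `m²ℓ² ≤ m₁²s²` ((2.1)); below: `e_c ≤ ē·s^{(4−d)/2}` ((2.5))
        (Sbox : ℝ) ≤ θ₃ * B2.rFn Q.R Q.r s → msq * P.mesh k ^ 2 ≤ m₁ ^ 2 * s ^ 2 →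
      -- `δ_A :=` THE (2.60) BOUND ITSELF (read off the printed (2.55)₁,₂ thresholds at `ℓ′ = s/L`), small in the two printed scalings: `Lᵏδ_A|e| ≤ t`, `Lᵏℓ|e|δ_A ≤ c_reg·e_c^β`
        (CV * P.d * (P.mesh k * (c₁ * B2.pFn Q.b₀ Q.p (s / (L : ℝ)))) + CF * Real.exp (-(δ * ρ₁)) * (c₁ * (1 / (μ₀ * (s / (L : ℝ)))) * B2.pFn Q.b₀ Q.p (s / (L : ℝ)))) * |C.e| ≤ t →
        ∀ {ec : ℝ}, 0 < ec → ec ≤ e₁ → ec ≤ ebar * s ^ (((4 : ℝ) - d) / 2) →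
          P.mesh k * |C.e| * (CV * P.d * (P.mesh k * (c₁ * B2.pFn Q.b₀ Q.p (s / (L : ℝ)))) + CF * Real.exp (-(δ * ρ₁)) * (c₁ * (1 / (μ₀ * (s / (L : ℝ)))) * B2.pFn Q.b₀ Q.p (s / (L : ℝ)))) ≤ creg * ec ^ β →
      -- `x ∈ Bᵏ(ȳ)` with `ȳ` the centre of `□₁` and at least `m` inside `□₂` in every direction
      ∀ (x : HiggsLattice.Site P 0),
        (∀ ν : Fin P.d, m ≤ ((blockIter k x) ν - q ν).val ∧ ((blockIter k x) ν - q ν).val + m < Sbox) →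
        (∀ ν : Fin P.d, ((blockIter k x) ν - q₁ ν).val = R₁) →
      -- THE PRINTED RESTRICTIONS (2.55) on `Λ₋₁` for `A′, φ` and the background `A^{(k)}`: thresholds `c₁p(ℓ′)`, `c₁p(ℓ′)/(μ₀ℓ′)`, `c₁p(ℓ′)`, `c₁p(ℓ′)/λ(ℓ′)^{1/4}` at `ℓ′ = s/L`
      ∀ (φ : HiggsLattice.ScalarField P k N),
        Restr255Printed C c₁ Q.b₀ Q.p μ₀ lam (s / (L : ℝ)) k Λm1 A' φ (ofSite (cutMin C₀ mu0sq aV k ζ (toSite A'))) →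
        ‖bgScalar256 C msq a k Λ₂ Λ₆ (ofSite (cutMin C₀ mu0sq aV k ζ (toSite A'))) φ x
            - avgQkAdj C (ofSite (cutMin C₀ mu0sq aV k ζ (toSite A'))) k φ x‖
          ≤ C' * B1.aSeq a P.L k * s ^ κ + C'' * B2.pFn Q.b₀ Q.p s + C''' * s ^ κ₀ := by
  obtain ⟨δ, CV, CF, hδ, hCV, hCF, K₀min, h⟩ :=
    eq265_higgs_region_size_charge d L hd hL ha hmsq haV hmu0 N C ε₀ creg β hcreg hβ Q hQ hc₁ hlam hθ₁ hθ₂ κ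
  refine ⟨δ, CV, CF, hδ, hCV, hCF, K₀min, fun K₀ hK₀ => ?_⟩
  obtain ⟨e₁, t, he₁, ht, C₁, C₂, C₃, D₁, D₂, D₃, D₄, hC₁, hC₂, hC₃, hD₁, hD₂, hD₃, hD₄, C', hC', E₁, E₂, E₃, hE₁, hE₂, hE₃, h⟩ :=
    h K₀ hK₀
  -- the dictionary constants `C″, C‴` from the fixed data and `K₀` (F21a `B2Eq265Dictionary.dictionary_bound`)
  have hLr : 1 < (L : ℝ) := by exact_mod_cast hL.2
  obtain ⟨C'', C''', hC'', hC''', hdict⟩ := dictionary_bound d hd3 (m₁ := m₁) (Kc := (K₀ : ℝ)) hLr ha hQ.2.2.2.2.2.2.1.le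
    (lt_trans two_pos hQ.1) hQ.2.2.2.2.2.2.2.le (lt_trans one_pos hQ.2.1).le hlam hc₁ hcreg hβ hebar hθ₃ (Nat.cast_nonneg K₀) hC₃
    hE₁ hE₂ hE₃ hκ₁ hκ₂
  refine ⟨e₁, t, he₁, ht, C₁, C₂, C₃, D₁, D₂, D₃, D₄, hC₁, hC₂, hC₃, hD₁, hD₂, hD₃, hD₄, C', hC', E₁, E₂, E₃, hE₁, hE₂, hE₃,
    C'', C''', hC'', hC''', ?_⟩
  intro P S hPd hPL hK₀M k hk1 hkK h3 hε h1 Λ₂ Λ₆ sq₂ sq₁ Sfin q Sbox h62 hs2 h16 hΩΛ hbox hSbox hsq₂ h2S q₁ R₁ m hR₁m hRm hsq₁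
    Λm1 ζ ρ ρ₁ hρ₁ zeta_abs zeta_supp zeta_one zeta_lip Rn hRn hRn2 hcube C₀ A' μ₀ hμ₀ s hs hs1 hθm hθR hS3 hm₁ ht' ec hec hle hecs
    hsmall x hmargin hcentre φ h255
  have hmain := h P S hPd hPL hK₀M hk1 hkK h3 hε h1 Λ₂ Λ₆ sq₂ sq₁ Sfin q Sbox h62 hs2 h16 hΩΛ hbox hSbox hsq₂ h2S q₁ R₁ m hR₁m hRm hsq₁
    Λm1 ζ ρ ρ₁ hρ₁ zeta_abs zeta_supp zeta_one zeta_lip Rn hRn hRn2 hcube C₀ A' hμ₀ hs hs1 hθm hθR ht' hec hle hsmall x hmargin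
    hcentre φ h255
  refine hmain.trans ?_
  -- `a(1 − L⁻²) ≤ a_k ≤ a` ([Balaban1982Higgs1] (2.15)), `0 < ℓ = P.mesh k ≤ 1`, and the dictionary step
  have hLP : 1 < (P.L : ℝ) := by rw [hPL]; exact hLr
  have hak1 : a * (1 - ((L : ℝ) ^ 2)⁻¹) ≤ B1.aSeq a P.L k := by
    have hlt := B1.ainf_lt_aSeq ha hLP k hk1
    rw [hPL] at hlt ⊢
    exact hlt.le
  have hak2 : B1.aSeq a P.L k ≤ a := B1.aSeq_le ha hLP k hk1
  have key := hdict hs hs1 hak1 hak2 (P.mesh_pos k) h1 hec hecs (Nat.cast_nonneg Sbox) hS3 hmsq.le hm₁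
  rw [hPd]
  linarith [key]

/-! ## §2 Print's own tower regions, cube size `M` -/

/-- **THE SAME FOR PRINT'S OWN REGIONS `Λ₂^{(k−1)′} ⊇ Λ₆^{(k−1)′}`, `Λ₋₁^{(k−1)′} ⊇ (near Λ₀^{(k−1)} r)′`.**  TYPED vs PRINTED: own F20
`B2Eq265SmallCharge.eq265_higgs_tower_size_charge` with the located edits of `eq265_higgs_region_remainder` (level `j + 1`, cube size
`M`); `rad`, `bad` data; nothing minted. [cite: Balaban1982Higgs2, Lemma 2.4 (2.65) p.572, (2.5) p.557, (2.7)–(2.8) p.558, (2.43) p.566, (2.55)–(2.56) p.570, (2.60) p.571]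
[cite: Balaban1982Higgs1, Prop. 2.1 p.610 «let Ω^{(k)} ⊂ T^{(k)}_1 be a sum of big blocks with M sufficiently large», (2.15) p.609] -/
theorem eq265_higgs_tower_remainder (d L : ℕ) (hd : 1 ≤ d) (hd3 : d ≤ 3) (hL : Odd L ∧ 1 < L) {a : ℝ} (ha : 0 < a) {msq : ℝ} (hmsq : 0 < msq)
    {aV : ℝ} (haV : 0 < aV) {mu0sq : ℝ} (hmu0 : 0 < mu0sq)
    (N : ℕ) (C : ChargeData N) (ε₀ : ℝ) (creg β : ℝ) (hcreg : 0 ≤ creg) (hβ : 0 < β)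
    (Q : B2.Params) (hQ : Q.Printed) {c₁ lam : ℝ} (hc₁ : 0 ≤ c₁) (hlam : 0 < lam) {θ₁ θ₂ : ℝ} (hθ₁ : 0 < θ₁) (hθ₂ : 0 < θ₂)
    (κ : ℝ) {ebar θ₃ m₁ κ₀ : ℝ} (hebar : 0 ≤ ebar) (hθ₃ : 0 ≤ θ₃)
    (hκ₁ : κ₀ + ((4 : ℝ) - d) / 4 < β * (((4 : ℝ) - d) / 2)) (hκ₂ : κ₀ + ((4 : ℝ) - d) / 4 < 2) :
    ∃ δ CV CF : ℝ, 0 < δ ∧ 0 < CV ∧ 0 < CF ∧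
    ∃ Mmin : ℕ, ∀ M : ℕ, Mmin ≤ M → ∃ e₁ t : ℝ, 0 < e₁ ∧ 0 < t ∧
      ∃ C₁ C₂ C₃ D₁ D₂ D₃ D₄ : ℝ, 0 ≤ C₁ ∧ 0 ≤ C₂ ∧ 0 ≤ C₃ ∧ 0 ≤ D₁ ∧ 0 ≤ D₂ ∧ 0 ≤ D₃ ∧ 0 ≤ D₄ ∧ ∃ C' : ℝ, 0 ≤ C' ∧
      ∃ E₁ E₂ E₃ : ℝ, 0 ≤ E₁ ∧ 0 ≤ E₂ ∧ 0 ≤ E₃ ∧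
      ∃ C'' C''' : ℝ, 0 ≤ C'' ∧ 0 ≤ C''' ∧
      ∀ (P : HiggsLattice.Params) (_ : Shape P), P.d = d → P.L = L → P.M = M →
      ∀ {j : ℕ}, j + 1 ≤ P.K → (∀ μ, 3 * half P (j + 1) M ≤ P.sitesPerDir 0 μ) → P.mesh (j + 1) ≤ ε₀ → P.mesh (j + 1) ≤ 1 →
      -- PRINT'S OWN REGIONS: the (2.7)–(2.8)/(2.43) tower of step `j`, primed to `T^{(k)}`, `k = j + 1`; `Λ₂′ ⊇ □₂`, `Λ₆′ ⊇ □₁`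
      ∀ (bad : (l : ℕ) → Set (HiggsLattice.Site P l)) (rad : ℕ → ℝ), 0 < rad j →
      ∀ (sq₂ sq₁ : Finset (HiggsLattice.Site P (j + 1))) (S : Fin P.d → Finset ℕ) (q : HiggsLattice.Site P (j + 1)) (Sbox : ℕ),
        sq₂ ⊆ prime (towerRegion bad rad j 2) → sq₁ ⊆ prime (towerRegion bad rad j 6) →
        underRegion (j + 1) sq₂ = cellBox (j + 1) M S →
        (∀ μ : Fin P.d, P.L ^ (j + 1) * Sbox < P.sitesPerDir 0 μ) →
      -- `□₂` IS the box `q + [0,S)ᵈ` of coarse sites, `□ = B^k(□₂)` smaller than half the torus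
        (∀ y : HiggsLattice.Site P (j + 1), y ∈ sq₂ ↔ ∀ ν : Fin P.d, (y ν - q ν).val < Sbox) →
        (∀ μ : Fin P.d, 2 * (P.L ^ (j + 1) * Sbox) ≤ P.sitesPerDir 0 μ) →
      -- `□₁` is the box of coarse sites of radius `R₁` (corner `q₁`); `m ≥ R₁` a coarse margin with `Lᵏm ≥` the depth radius
      ∀ (q₁ : HiggsLattice.Site P (j + 1)) (R₁ m : ℕ), R₁ ≤ m → 2 * rS P (j + 1) M + 2 * half P (j + 1) M * (P.d + 1) + 1 ≤ P.L ^ (j + 1) * m →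
        (∀ y : HiggsLattice.Site P (j + 1), y ∈ sq₁ ↔ ∀ ν : Fin P.d, (y ν - q₁ ν).val < 2 * R₁ + 1) →
      -- the cutoff `ζ^{(k)}` of (2.44)
      ∀ (ζ : HiggsLattice.Site P 0 → HiggsLattice.Site P (j + 1) → ℝ) (ρ ρ₁ : ℝ), 0 ≤ ρ₁ →
        (∀ x y', |ζ x y'| ≤ 1) →
        (∀ x y', ζ x y' ≠ 0 → (HiggsLattice.Site.tdist (blockIter (j + 1) x) y' : ℝ) ≤ ρ) →
        (∀ x y', (HiggsLattice.Site.tdist (blockIter (j + 1) x) y' : ℝ) ≤ ρ₁ → ζ x y' = 1) →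
        (∀ (x : HiggsLattice.Site P 0) (ν : Fin P.d) (y' : HiggsLattice.Site P (j + 1)), |ζ (x.shift ν) y' - ζ x y'| ≤ ((P.L : ℝ) ^ (j + 1))⁻¹) →
      -- the cube of radius `R_n ≥ ρ + 1` about `y ∈ Λ₂′` lies in `Λ₋₁′ := (near Λ₀^{(j)} r(Lʲε))′` once `L(R_n + 1) − 1 ≤ 3n`, `n < r(Lʲε)` ((2.8) collars)
      ∀ (Rn : ℕ), ρ + 1 ≤ (Rn : ℝ) → (∀ μ : Fin P.d, 2 * (2 * Rn + 1) ≤ P.sitesPerDir (j + 1) μ) →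
      ∀ (n : ℕ), (n : ℝ) < rad j → (P.L : ℝ) * ((Rn : ℝ) + 1) - 1 ≤ 3 * (n : ℝ) →
      -- a charge datum on `ℝ^d`, the step's vector field `A′`, and print's `μ₀` of the (2.55)₂ threshold
      ∀ (C₀ : ChargeData P.d) (A' : HiggsLattice.VecField P (j + 1)) {μ₀ : ℝ}, 0 < μ₀ →
      -- THE PHYSICAL SCALE `s ⇐ Lᵏε` AS A FREE LETTER (F18a), the (2.55) letter `L^{k−1}ε ⇐ s/L`: radii readings `m ≥ θ₁r(s)`, `R₁ + 1 ≥ θ₂r(s)`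
      ∀ {s : ℝ}, 0 < s → s ≤ 1 →
        θ₁ * B2.rFn Q.R Q.r s ≤ (m : ℝ) → θ₂ * B2.rFn Q.R Q.r s ≤ (R₁ : ℝ) + 1 →
      -- THE DICTIONARY READ at `s ⇐ Lᵏε`: the side of `□₂` `S ≤ θ₃r(s)` (p.572, (2.7)), the mass term `m²ℓ² ≤ m₁²s²` ((2.1)); below: `e_c ≤ ē·s^{(4−d)/2}` ((2.5))
        (Sbox : ℝ) ≤ θ₃ * B2.rFn Q.R Q.r s → msq * P.mesh (j + 1) ^ 2 ≤ m₁ ^ 2 * s ^ 2 →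
      -- `δ_A :=` THE (2.60) BOUND ITSELF (read off the printed (2.55)₁,₂ thresholds at `ℓ′ = s/L`), small in the two printed scalings: `Lᵏδ_A|e| ≤ t`, `Lᵏℓ|e|δ_A ≤ c_reg·e_c^β`
        (CV * P.d * (P.mesh (j + 1) * (c₁ * B2.pFn Q.b₀ Q.p (s / (L : ℝ)))) + CF * Real.exp (-(δ * ρ₁)) * (c₁ * (1 / (μ₀ * (s / (L : ℝ)))) * B2.pFn Q.b₀ Q.p (s / (L : ℝ)))) * |C.e| ≤ t →
        ∀ {ec : ℝ}, 0 < ec → ec ≤ e₁ → ec ≤ ebar * s ^ (((4 : ℝ) - d) / 2) →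
          P.mesh (j + 1) * |C.e| * (CV * P.d * (P.mesh (j + 1) * (c₁ * B2.pFn Q.b₀ Q.p (s / (L : ℝ)))) + CF * Real.exp (-(δ * ρ₁)) * (c₁ * (1 / (μ₀ * (s / (L : ℝ)))) * B2.pFn Q.b₀ Q.p (s / (L : ℝ)))) ≤ creg * ec ^ β →
      -- `x ∈ Bᵏ(ȳ)` with `ȳ` the centre of `□₁` and at least `m` inside `□₂` in every direction
      ∀ (x : HiggsLattice.Site P 0),
        (∀ ν : Fin P.d, m ≤ ((blockIter (j + 1) x) ν - q ν).val ∧ ((blockIter (j + 1) x) ν - q ν).val + m < Sbox) →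
        (∀ ν : Fin P.d, ((blockIter (j + 1) x) ν - q₁ ν).val = R₁) →
      -- THE PRINTED RESTRICTIONS (2.55) on `Λ₋₁` for `A′, φ` and the background `A^{(k)}`: thresholds `c₁p(ℓ′)`, `c₁p(ℓ′)/(μ₀ℓ′)`, `c₁p(ℓ′)`, `c₁p(ℓ′)/λ(ℓ′)^{1/4}` at `ℓ′ = s/L`
      ∀ (φ : HiggsLattice.ScalarField P (j + 1) N),
        Restr255Printed C c₁ Q.b₀ Q.p μ₀ lam (s / (L : ℝ)) (j + 1) (prime (near (towerRegion bad rad j 0) (rad j))) A' φ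
          (ofSite (cutMin C₀ mu0sq aV (j + 1) ζ (toSite A'))) →
        ‖bgScalar256 C msq a (j + 1) (prime (towerRegion bad rad j 2)) (prime (towerRegion bad rad j 6))
              (ofSite (cutMin C₀ mu0sq aV (j + 1) ζ (toSite A'))) φ x
            - avgQkAdj C (ofSite (cutMin C₀ mu0sq aV (j + 1) ζ (toSite A'))) (j + 1) φ x‖
          ≤ C' * B1.aSeq a P.L (j + 1) * s ^ κ + C'' * B2.pFn Q.b₀ Q.p s + C''' * s ^ κ₀ := by
  obtain ⟨δ, CV, CF, hδ, hCV, hCF, Mmin, h⟩ :=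
    eq265_higgs_tower_size_charge d L hd hL ha hmsq haV hmu0 N C ε₀ creg β hcreg hβ Q hQ hc₁ hlam hθ₁ hθ₂ κ
  refine ⟨δ, CV, CF, hδ, hCV, hCF, Mmin, fun M hM => ?_⟩
  obtain ⟨e₁, t, he₁, ht, C₁, C₂, C₃, D₁, D₂, D₃, D₄, hC₁, hC₂, hC₃, hD₁, hD₂, hD₃, hD₄, C', hC', E₁, E₂, E₃, hE₁, hE₂, hE₃, h⟩ :=
    h M hM
  -- the dictionary constants `C″, C‴` from the fixed data and `M` (F21a `B2Eq265Dictionary.dictionary_bound`)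
  have hLr : 1 < (L : ℝ) := by exact_mod_cast hL.2
  obtain ⟨C'', C''', hC'', hC''', hdict⟩ := dictionary_bound d hd3 (m₁ := m₁) (Kc := (M : ℝ)) hLr ha hQ.2.2.2.2.2.2.1.le
    (lt_trans two_pos hQ.1) hQ.2.2.2.2.2.2.2.le (lt_trans one_pos hQ.2.1).le hlam hc₁ hcreg hβ hebar hθ₃ (Nat.cast_nonneg M) hC₃
    hE₁ hE₂ hE₃ hκ₁ hκ₂
  refine ⟨e₁, t, he₁, ht, C₁, C₂, C₃, D₁, D₂, D₃, D₄, hC₁, hC₂, hC₃, hD₁, hD₂, hD₃, hD₄, C', hC', E₁, E₂, E₃, hE₁, hE₂, hE₃,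
    C'', C''', hC'', hC''', ?_⟩
  intro P S hPd hPL hPM j hjK h3 hε h1 bad rad hrad sq₂ sq₁ Sfin q Sbox hs2 h16 hbox hSbox hsq₂ h2S q₁ R₁ m hR₁m hRm hsq₁
    ζ ρ ρ₁ hρ₁ zeta_abs zeta_supp zeta_one zeta_lip Rn hRn hRn2 n hn hroom C₀ A' μ₀ hμ₀ s hs hs1 hθm hθR hS3 hm₁ ht' ec hec hle hecs
    hsmall x hmargin hcentre φ h255
  have hmain := h P S hPd hPL hPM hjK h3 hε h1 bad rad hrad sq₂ sq₁ Sfin q Sbox hs2 h16 hbox hSbox hsq₂ h2S q₁ R₁ m hR₁m hRm hsq₁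
    ζ ρ ρ₁ hρ₁ zeta_abs zeta_supp zeta_one zeta_lip Rn hRn hRn2 n hn hroom C₀ A' hμ₀ hs hs1 hθm hθR ht' hec hle hsmall x hmargin
    hcentre φ h255
  refine hmain.trans ?_
  -- `a(1 − L⁻²) ≤ a_{j+1} ≤ a` ([Balaban1982Higgs1] (2.15)), `0 < ℓ = P.mesh (j + 1) ≤ 1`, and the dictionary step
  have hLP : 1 < (P.L : ℝ) := by rw [hPL]; exact hLr
  have hj1 : 1 ≤ j + 1 := Nat.succ_le_succ (Nat.zero_le j)
  have hak1 : a * (1 - ((L : ℝ) ^ 2)⁻¹) ≤ B1.aSeq a P.L (j + 1) := by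
    have hlt := B1.ainf_lt_aSeq ha hLP (j + 1) hj1
    rw [hPL] at hlt ⊢
    exact hlt.le
  have hak2 : B1.aSeq a P.L (j + 1) ≤ a := B1.aSeq_le ha hLP (j + 1) hj1
  have key := hdict hs hs1 hak1 hak2 (P.mesh_pos (j + 1)) h1 hec hecs (Nat.cast_nonneg Sbox) hS3 hmsq.le hm₁
  rw [hPd]
  linarith [key]

/-! ## §3 The printed instance `β = 1` -/

/-- **THE PRINTED INSTANCE `β = 1`** of `eq265_higgs_region_remainder`: print's errors in (2.68)/(2.76) are linear in `e(Lᵏε)`, so the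
regularity pair is `(c_reg, 1)` and the only exponent condition is `κ₀ < (4−d)/4` (`B2Eq265Dictionary.printed_exponents`; print p.572:
«κ₀ > 0»).  TYPED vs PRINTED: `eq265_higgs_region_remainder` with `β := 1` (`hβ := one_pos`; `c_reg·e_c^1` written `c_reg·e_c`) and the two
exponent conditions replaced by `(hκ₀ : κ₀ < (4−d)/4)`; the tower twin is the same instantiation of `eq265_higgs_tower_remainder` (not spelled out).
[cite: Balaban1982Higgs2, Lemma 2.4 (2.65) p.572, (2.68) p.572 «+ O((Lᵏε)^{κ₀}), κ₀ > 0», (2.76) p.573, (2.5) p.557] -/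
theorem eq265_higgs_region_remainder_printed (d L : ℕ) (hd : 1 ≤ d) (hd3 : d ≤ 3) (hL : Odd L ∧ 1 < L) {a : ℝ} (ha : 0 < a) {msq : ℝ} (hmsq : 0 < msq)
    {aV : ℝ} (haV : 0 < aV) {mu0sq : ℝ} (hmu0 : 0 < mu0sq)
    (N : ℕ) (C : ChargeData N) (ε₀ : ℝ) (creg : ℝ) (hcreg : 0 ≤ creg)
    (Q : B2.Params) (hQ : Q.Printed) {c₁ lam : ℝ} (hc₁ : 0 ≤ c₁) (hlam : 0 < lam) {θ₁ θ₂ : ℝ} (hθ₁ : 0 < θ₁) (hθ₂ : 0 < θ₂)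
    (κ : ℝ) {ebar θ₃ m₁ κ₀ : ℝ} (hebar : 0 ≤ ebar) (hθ₃ : 0 ≤ θ₃)
    (hκ₀ : κ₀ < ((4 : ℝ) - d) / 4) :
    ∃ δ CV CF : ℝ, 0 < δ ∧ 0 < CV ∧ 0 < CF ∧
    ∃ K₀min : ℕ, ∀ K₀ : ℕ, K₀min ≤ K₀ → ∃ e₁ t : ℝ, 0 < e₁ ∧ 0 < t ∧
      ∃ C₁ C₂ C₃ D₁ D₂ D₃ D₄ : ℝ, 0 ≤ C₁ ∧ 0 ≤ C₂ ∧ 0 ≤ C₃ ∧ 0 ≤ D₁ ∧ 0 ≤ D₂ ∧ 0 ≤ D₃ ∧ 0 ≤ D₄ ∧ ∃ C' : ℝ, 0 ≤ C' ∧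
      ∃ E₁ E₂ E₃ : ℝ, 0 ≤ E₁ ∧ 0 ≤ E₂ ∧ 0 ≤ E₃ ∧
      ∃ C'' C''' : ℝ, 0 ≤ C'' ∧ 0 ≤ C''' ∧
      ∀ (P : HiggsLattice.Params) (_ : Shape P), P.d = d → P.L = L → K₀ ∣ P.M →
      ∀ {k : ℕ}, 1 ≤ k → k ≤ P.K → (∀ μ, 3 * half P k K₀ ≤ P.sitesPerDir 0 μ) → P.mesh k ≤ ε₀ → P.mesh k ≤ 1 →
      ∀ (Λ₂ Λ₆ sq₂ sq₁ : Finset (HiggsLattice.Site P k)) (S : Fin P.d → Finset ℕ) (q : HiggsLattice.Site P k) (Sbox : ℕ),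
        Λ₆ ⊆ Λ₂ → sq₂ ⊆ Λ₂ → sq₁ ⊆ Λ₆ →
        IsBigBlockUnion k K₀ (underRegion k Λ₂) → underRegion k sq₂ = cellBox k K₀ S →
        (∀ μ : Fin P.d, P.L ^ k * Sbox < P.sitesPerDir 0 μ) →
      -- `□₂` IS the box `q + [0,S)ᵈ` of coarse sites, `□ = B^k(□₂)` smaller than half the torus
        (∀ y : HiggsLattice.Site P k, y ∈ sq₂ ↔ ∀ ν : Fin P.d, (y ν - q ν).val < Sbox) →
        (∀ μ : Fin P.d, 2 * (P.L ^ k * Sbox) ≤ P.sitesPerDir 0 μ) →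
      -- `□₁` is the box of coarse sites of radius `R₁` (corner `q₁`); `m ≥ R₁` a coarse margin with `Lᵏm ≥` the depth radius
      ∀ (q₁ : HiggsLattice.Site P k) (R₁ m : ℕ), R₁ ≤ m → 2 * rS P k K₀ + 2 * half P k K₀ * (P.d + 1) + 1 ≤ P.L ^ k * m →
        (∀ y : HiggsLattice.Site P k, y ∈ sq₁ ↔ ∀ ν : Fin P.d, (y ν - q₁ ν).val < 2 * R₁ + 1) →
      -- the region `Λ₋₁` of (2.55); the cutoff `ζ^{(k)}` of (2.44); the cube of radius `R_n ≥ ρ + 1` about every `y ∈ Λ₂` inside `Λ₋₁` ((2.8))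
      ∀ (Λm1 : Finset (HiggsLattice.Site P k))
        (ζ : HiggsLattice.Site P 0 → HiggsLattice.Site P k → ℝ) (ρ ρ₁ : ℝ), 0 ≤ ρ₁ →
        (∀ x y', |ζ x y'| ≤ 1) →
        (∀ x y', ζ x y' ≠ 0 → (HiggsLattice.Site.tdist (blockIter k x) y' : ℝ) ≤ ρ) →
        (∀ x y', (HiggsLattice.Site.tdist (blockIter k x) y' : ℝ) ≤ ρ₁ → ζ x y' = 1) →
        (∀ (x : HiggsLattice.Site P 0) (ν : Fin P.d) (y' : HiggsLattice.Site P k), |ζ (x.shift ν) y' - ζ x y'| ≤ ((P.L : ℝ) ^ k)⁻¹) →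
      ∀ (Rn : ℕ), ρ + 1 ≤ (Rn : ℝ) → (∀ μ : Fin P.d, 2 * (2 * Rn + 1) ≤ P.sitesPerDir k μ) →
        (∀ y ∈ Λ₂, ∀ y' : HiggsLattice.Site P k, HiggsLattice.Site.tdist y y' ≤ Rn → y' ∈ Λm1) →
      -- a charge datum on `ℝ^d`, the step's vector field `A′`, and print's `μ₀` of the (2.55)₂ threshold
      ∀ (C₀ : ChargeData P.d) (A' : HiggsLattice.VecField P k) {μ₀ : ℝ}, 0 < μ₀ →
      -- THE PHYSICAL SCALE `s ⇐ Lᵏε` AS A FREE LETTER (F18a), the (2.55) letter `L^{k−1}ε ⇐ s/L`: radii readings `m ≥ θ₁r(s)`, `R₁ + 1 ≥ θ₂r(s)`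
      ∀ {s : ℝ}, 0 < s → s ≤ 1 →
        θ₁ * B2.rFn Q.R Q.r s ≤ (m : ℝ) → θ₂ * B2.rFn Q.R Q.r s ≤ (R₁ : ℝ) + 1 →
      -- THE DICTIONARY READ at `s ⇐ Lᵏε`: the side of `□₂` `S ≤ θ₃r(s)` (p.572, (2.7)), the mass term `m²ℓ² ≤ m₁²s²` ((2.1)); below: `e_c ≤ ē·s^{(4−d)/2}` ((2.5))
        (Sbox : ℝ) ≤ θ₃ * B2.rFn Q.R Q.r s → msq * P.mesh k ^ 2 ≤ m₁ ^ 2 * s ^ 2 →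
      -- `δ_A :=` THE (2.60) BOUND ITSELF (read off the printed (2.55)₁,₂ thresholds at `ℓ′ = s/L`), small in the two printed scalings: `Lᵏδ_A|e| ≤ t`, `Lᵏℓ|e|δ_A ≤ c_reg·e_c` (`β = 1`)
        (CV * P.d * (P.mesh k * (c₁ * B2.pFn Q.b₀ Q.p (s / (L : ℝ)))) + CF * Real.exp (-(δ * ρ₁)) * (c₁ * (1 / (μ₀ * (s / (L : ℝ)))) * B2.pFn Q.b₀ Q.p (s / (L : ℝ)))) * |C.e| ≤ t →
        ∀ {ec : ℝ}, 0 < ec → ec ≤ e₁ → ec ≤ ebar * s ^ (((4 : ℝ) - d) / 2) →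
          P.mesh k * |C.e| * (CV * P.d * (P.mesh k * (c₁ * B2.pFn Q.b₀ Q.p (s / (L : ℝ)))) + CF * Real.exp (-(δ * ρ₁)) * (c₁ * (1 / (μ₀ * (s / (L : ℝ)))) * B2.pFn Q.b₀ Q.p (s / (L : ℝ)))) ≤ creg * ec →
      -- `x ∈ Bᵏ(ȳ)` with `ȳ` the centre of `□₁` and at least `m` inside `□₂` in every direction
      ∀ (x : HiggsLattice.Site P 0),
        (∀ ν : Fin P.d, m ≤ ((blockIter k x) ν - q ν).val ∧ ((blockIter k x) ν - q ν).val + m < Sbox) →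
        (∀ ν : Fin P.d, ((blockIter k x) ν - q₁ ν).val = R₁) →
      -- THE PRINTED RESTRICTIONS (2.55) on `Λ₋₁` for `A′, φ` and the background `A^{(k)}`: thresholds `c₁p(ℓ′)`, `c₁p(ℓ′)/(μ₀ℓ′)`, `c₁p(ℓ′)`, `c₁p(ℓ′)/λ(ℓ′)^{1/4}` at `ℓ′ = s/L`
      ∀ (φ : HiggsLattice.ScalarField P k N),
        Restr255Printed C c₁ Q.b₀ Q.p μ₀ lam (s / (L : ℝ)) k Λm1 A' φ (ofSite (cutMin C₀ mu0sq aV k ζ (toSite A'))) →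
        ‖bgScalar256 C msq a k Λ₂ Λ₆ (ofSite (cutMin C₀ mu0sq aV k ζ (toSite A'))) φ x
            - avgQkAdj C (ofSite (cutMin C₀ mu0sq aV k ζ (toSite A'))) k φ x‖
          ≤ C' * B1.aSeq a P.L k * s ^ κ + C'' * B2.pFn Q.b₀ Q.p s + C''' * s ^ κ₀ := by
  obtain ⟨hκ₁, hκ₂⟩ := B2Eq265Dictionary.printed_exponents hd hκ₀
  obtain ⟨δ, CV, CF, hδ, hCV, hCF, K₀min, h⟩ := eq265_higgs_region_remainder d L hd hd3 hL ha hmsq haV hmu0 N C ε₀ creg 1 hcreg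
    one_pos Q hQ hc₁ hlam hθ₁ hθ₂ κ hebar hθ₃ hκ₁ hκ₂
  refine ⟨δ, CV, CF, hδ, hCV, hCF, K₀min, fun K₀ hK₀ => ?_⟩
  obtain ⟨e₁, t, he₁, ht, C₁, C₂, C₃, D₁, D₂, D₃, D₄, hC₁, hC₂, hC₃, hD₁, hD₂, hD₃, hD₄, C', hC', E₁, E₂, E₃, hE₁, hE₂, hE₃,
    C'', C''', hC'', hC''', h⟩ := h K₀ hK₀
  refine ⟨e₁, t, he₁, ht, C₁, C₂, C₃, D₁, D₂, D₃, D₄, hC₁, hC₂, hC₃, hD₁, hD₂, hD₃, hD₄, C', hC', E₁, E₂, E₃, hE₁, hE₂, hE₃,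
    C'', C''', hC'', hC''', ?_⟩
  intro P S hPd hPL hK₀M k hk1 hkK h3 hε h1 Λ₂ Λ₆ sq₂ sq₁ Sfin q Sbox h62 hs2 h16 hΩΛ hbox hSbox hsq₂ h2S q₁ R₁ m hR₁m hRm hsq₁
    Λm1 ζ ρ ρ₁ hρ₁ zeta_abs zeta_supp zeta_one zeta_lip Rn hRn hRn2 hcube C₀ A' μ₀ hμ₀ s hs hs1 hθm hθR hS3 hm₁ ht' ec hec hle hecs
    hsmall x hmargin hcentre φ h255
  exact h P S hPd hPL hK₀M hk1 hkK h3 hε h1 Λ₂ Λ₆ sq₂ sq₁ Sfin q Sbox h62 hs2 h16 hΩΛ hbox hSbox hsq₂ h2S q₁ R₁ m hR₁m hRm hsq₁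
    Λm1 ζ ρ ρ₁ hρ₁ zeta_abs zeta_supp zeta_one zeta_lip Rn hRn hRn2 hcube C₀ A' hμ₀ hs hs1 hθm hθR hS3 hm₁ ht' hec hle hecs
    (by rwa [Real.rpow_one]) x hmargin hcentre φ h255

end Literature.MathematicalPhysics.QuantumFieldTheory.Balaban1983to89.B2Eq265PrintedRemainder

end
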